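import Mathlib
import Literature.Computability.Complexity.RangeAvoidance
import Literature.Computability.Complexity.SignDegreeXor
import Summits.PneNP.PneNP.Theorems.PstarPDT
import Summits.PneNP.PneNP.Theorems.PstarFibrePolys
import Summits.PneNP.PneNP.Theorems.PstarSALevel
import Summits.PneNP.PneNP.Theorems.PstarTyped
import Summits.PneNP.PneNP.Theorems.PstarGapLinearised
import Summits.PneNP.PneNP.Theorems.PstarGapPeeling
import Summits.PneNP.PneNP.Theorems.PstarCentreFree
import Summits.PneNP.PneNP.Theorems.PstarGraphQuadGapTwoForms
import Summits.PneNP.PneNP.Theorems.PstarGapOneAll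
import Summits.PneNP.PneNP.Theorems.PstarGConstraint

/-!
# The reader-graph induction: AND-slot calculus and the chord step (c) (ROUND-24 item T24.17′, steps)

FRONTIER range-avoidance ladder, rung F-N3, ROUND 24 (cell `pnp-ideate`; restricted-model proof complexity — nothing here bears on
`P` versus `NP`).  Memo ROUND-24-PRESEED §13 R10(p)(c); referee AUDIT-r10p-gsat-g43 (P4, P6).

* `other`, `alpha`: for an AND-type variable `p`, `alpha I C G z p = [p ∈ C] + Σ_{g ∈ G, p ∈ andPair g} z_{other slot}` is the
  coefficient of `z_p` in the G-constraint: **`bit_gval_update_and`**: `bit (gval (z[p ↦ a])) = bit (gval z) + (bit a + bit z_p)·alpha z p`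
  (pairs non-degenerate), and `alpha_update_of_ne`: `alpha` at `p'` does not see `z_p` unless `{p,p'}` is a pair of `G`.
* **`gval_one_one`** (the heart of (c)): if `g ∈ J` is a chord (AND pair `p, p'` read by no other output of `J`), no pair of `G` is
  `{p,p'}`, and the G-constraint misses the value `b` on every solution of `J`, then for every solution `z` of `J ∖ g` the point
  `z[p ↦ 1][p' ↦ 1]` has `gval = ¬b` — whether the chord wants product `1` (then that point solves `J`) or `0` (then the three points
  `00, 10, 01` solve `J`, and multilinearity `w(11) = w(00) + w(10) + w(01)` transfers the value).
-/

set_option linter.dupNamespace false -- `Summit.PneNP.PneNP.…`: summit = sub-problem name (D-0017 single-conjunct layout)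

open Finset Literature.Computability.Complexity
open Summit.PneNP.PneNP.Theorems.PstarPDT (parity)
open Summit.PneNP.PneNP.Theorems.PstarFibrePolys (bit bit_injective)
open Summit.PneNP.PneNP.Theorems.PstarTyped (Typed)
open Summit.PneNP.PneNP.Theorems.PstarSALevel (varSet bdry)
open Summit.PneNP.PneNP.Theorems.PstarGapLinearised (andPair)
open Summit.PneNP.PneNP.Theorems.PstarGapPeeling (not_mem_varSet_of_private eval_update_of_not_mem eval_pure)
open Summit.PneNP.PneNP.Theorems.PstarCentreFree (vars_mem_varSet)
open Summit.PneNP.PneNP.Theorems.PstarGapOneAll (gval)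
open Summit.PneNP.PneNP.Theorems.PstarGConstraint

namespace Summit.PneNP.PneNP.Theorems.PstarGSatChord

variable {n m : ℕ}

/-- In `𝔽₂`, `x + x = 0`. -/
private theorem zmod2_add_self (x : ZMod 2) : x + x = 0 := by
  revert x; decide

/-! ## The coefficient of one AND variable -/

/-- The other slot of the AND pair of `g`, relative to `p`. -/
def other (I : LocalMap 4 n m) (g : Fin m) (p : Fin n) : Fin n := if I.vars g 2 = p then I.vars g 3 else I.vars g 2

/-- The coefficient of `z_p` in the G-constraint: `[p ∈ C] + Σ_{g ∈ G, p ∈ andPair g} z_{other}` (in `𝔽₂`). -/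
noncomputable def alpha (I : LocalMap 4 n m) (C : Finset (Fin n)) (G : Finset (Fin m)) (z : Fin n → Bool) (p : Fin n) : ZMod 2 :=
  (if p ∈ C then 1 else 0) + ∑ g ∈ G.filter (fun g => p ∈ andPair I g), bit (z (other I g p))

/-- Membership in an AND pair. -/
theorem mem_andPair_iff (I : LocalMap 4 n m) (g : Fin m) (p : Fin n) : p ∈ andPair I g ↔ I.vars g 2 = p ∨ I.vars g 3 = p := by
  unfold PstarGapLinearised.andPair
  rw [mem_insert, mem_singleton]
  constructor
  · rintro (h | h)
    exacts [Or.inl h.symm, Or.inr h.symm]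
  · rintro (h | h)
    exacts [Or.inl h.symm, Or.inr h.symm]

/-- The other slot differs from `p` (non-degenerate pair). -/
theorem other_ne (I : LocalMap 4 n m) {g : Fin m} (hnd : I.vars g 2 ≠ I.vars g 3) (p : Fin n) (hp : p ∈ andPair I g) :
    other I g p ≠ p := by
  unfold other
  rcases (mem_andPair_iff I g p).1 hp with h | h
  · rw [if_pos h]; exact fun e => hnd (h.trans e.symm)
  · by_cases h2 : I.vars g 2 = p
    · exact absurd (h2.trans h.symm) hnd
    · rw [if_neg h2]; exact h2

/-- `{p, other} = andPair g`. -/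
theorem pair_eq_of_mem (I : LocalMap 4 n m) {g : Fin m} (p : Fin n) (hp : p ∈ andPair I g) :
    ({p, other I g p} : Finset (Fin n)) = andPair I g := by
  unfold other PstarGapLinearised.andPair
  rcases (mem_andPair_iff I g p).1 hp with h | h
  · rw [if_pos h, h]
  · by_cases h2 : I.vars g 2 = p
    · rw [if_pos h2, h2]
    · rw [if_neg h2, ← h, pair_comm]

/-- **Updating one AND variable**: `bit (gval (z[p ↦ a])) = bit (gval z) + (bit a + bit z_p) · alpha z p`, for non-degenerate
pairs. -/
theorem bit_gval_update_and (I : LocalMap 4 n m) (C : Finset (Fin n)) {G : Finset (Fin m)}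
    (hnd : ∀ g ∈ G, I.vars g 2 ≠ I.vars g 3) (z : Fin n → Bool) (p : Fin n) (a : Bool) :
    bit (gval I C G (Function.update z p a)) = bit (gval I C G z) + (bit a + bit (z p)) * alpha I C G z p := by
  classical
  rw [bit_gval, bit_gval, alpha]
  -- the `C` part
  have hC : ∑ w ∈ C, bit (Function.update z p a w) = ∑ w ∈ C, bit (z w) + (bit a + bit (z p)) * if p ∈ C then 1 else 0 := by
    have key : ∀ w ∈ C, bit (Function.update z p a w) = bit (z w) + if w = p then bit a + bit (z p) else 0 := by
      intro w _
      by_cases h : w = p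
      · subst h
        rw [Function.update_self, if_pos rfl]
        have := zmod2_add_self (bit (z w))
        linear_combination -this
      · rw [Function.update_of_ne h, if_neg h, add_zero]
    rw [sum_congr rfl key, sum_add_distrib, sum_ite_eq']
    split_ifs <;> ring
  -- the `G` part
  have hG : ∑ g ∈ G, bit (Function.update z p a (I.vars g 2)) * bit (Function.update z p a (I.vars g 3)) =
      ∑ g ∈ G, bit (z (I.vars g 2)) * bit (z (I.vars g 3)) +
        (bit a + bit (z p)) * ∑ g ∈ G.filter (fun g => p ∈ andPair I g), bit (z (other I g p)) := by
    rw [mul_sum, sum_filter, ← sum_add_distrib]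
    refine sum_congr rfl fun g hg => ?_
    by_cases h2 : I.vars g 2 = p
    · have h3 : I.vars g 3 ≠ p := fun h => hnd g hg (h2.trans h.symm)
      have hmem : p ∈ andPair I g := (mem_andPair_iff I g p).2 (Or.inl h2)
      rw [if_pos hmem, h2, Function.update_self, Function.update_of_ne h3]
      unfold other
      rw [if_pos h2]
      have h2' := zmod2_add_self (bit (z p) * bit (z (I.vars g 3)))
      linear_combination -h2'
    · by_cases h3 : I.vars g 3 = p
      · have hmem : p ∈ andPair I g := (mem_andPair_iff I g p).2 (Or.inr h3)
        rw [if_pos hmem, h3, Function.update_self, Function.update_of_ne h2]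
        unfold other
        rw [if_neg h2]
        have h2' := zmod2_add_self (bit (z (I.vars g 2)) * bit (z p))
        linear_combination -h2'
      · have hmem : p ∉ andPair I g := fun h => by
          rcases (mem_andPair_iff I g p).1 h with e | e
          exacts [h2 e, h3 e]
        rw [if_neg hmem, Function.update_of_ne h2, Function.update_of_ne h3, add_zero]
  rw [hC, hG]
  ring

/-- `alpha` at `p'` ignores `z_p` when `{p, p'}` is not a pair of `G`. -/
theorem alpha_update_of_ne (I : LocalMap 4 n m) (C : Finset (Fin n)) {G : Finset (Fin m)} (z : Fin n → Bool) {p p' : Fin n}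
    (hno : ∀ g ∈ G, andPair I g ≠ {p, p'}) (a : Bool) :
    alpha I C G (Function.update z p a) p' = alpha I C G z p' := by
  classical
  unfold alpha
  congr 1
  refine sum_congr rfl fun g hg => ?_
  obtain ⟨hgG, hp'⟩ := mem_filter.1 hg
  rw [Function.update_of_ne]
  intro h
  apply hno g hgG
  rw [← pair_eq_of_mem I p' hp', h, pair_comm]

/-! ## The chord step -/

section Chord

variable (I : LocalMap 4 n m) (hI : I.IsPure xorAndPred) (y : Fin m → Bool) (J G : Finset (Fin m)) (C : Finset (Fin n))
  (b : Bool) (hnd : ∀ g ∈ G, I.vars g 2 ≠ I.vars g 3)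
  (hunsat : ∀ z : Fin n → Bool, (∀ j ∈ J, I.eval z j = y j) → gval I C G z ≠ b)

include hI hnd hunsat

/-- **The chord forces `gval = ¬b` at `(1,1)`** over every solution of `J ∖ g`. -/
theorem gval_one_one {g : Fin m}
    (hpriv2 : ∀ j ∈ J, j ≠ g → I.vars g 2 ∉ varSet I j) (hpriv3 : ∀ j ∈ J, j ≠ g → I.vars g 3 ∉ varSet I j)
    (hno : ∀ g' ∈ G, andPair I g' ≠ {I.vars g 2, I.vars g 3})
    {z : Fin n → Bool} (hz : ∀ j ∈ J, j ≠ g → I.eval z j = y j) :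
    gval I C G (Function.update (Function.update z (I.vars g 2) true) (I.vars g 3) true) = !b := by
  classical
  have h23 : I.vars g 2 ≠ I.vars g 3 := fun h => absurd (hI.2 g h) (by decide)
  -- the four points solve `J ∖ g`
  have hsol : ∀ a c : Bool, ∀ j ∈ J, j ≠ g →
      I.eval (Function.update (Function.update z (I.vars g 2) a) (I.vars g 3) c) j = y j := by
    intro a c j hj hne
    rw [eval_update_of_not_mem I j _ (hpriv3 j hj hne), eval_update_of_not_mem I j _ (hpriv2 j hj hne)]
    exact hz j hj hne
  -- value of `g` at the four points
  have hev : ∀ a c : Bool, I.eval (Function.update (Function.update z (I.vars g 2) a) (I.vars g 3) c) g =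
      xor (xor (z (I.vars g 0)) (z (I.vars g 1))) (a && c) := by
    intro a c
    have hinj := hI.2 g
    have hne : ∀ s t : Fin 4, s ≠ t → I.vars g s ≠ I.vars g t := fun s t hst h => hst (hinj h)
    rw [eval_pure I hI, Function.update_self, Function.update_of_ne (hne 2 3 (by decide)), Function.update_self,
      Function.update_of_ne (hne 0 3 (by decide)), Function.update_of_ne (hne 0 2 (by decide)),
      Function.update_of_ne (hne 1 3 (by decide)), Function.update_of_ne (hne 1 2 (by decide))]
  -- a point solving `g` has `gval = ¬b`
  have hval : ∀ a c : Bool, xor (xor (z (I.vars g 0)) (z (I.vars g 1))) (a && c) = y g →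
      gval I C G (Function.update (Function.update z (I.vars g 2) a) (I.vars g 3) c) = !b := by
    intro a c hac
    have hne := hunsat _ fun j hj => if h : j = g then by rw [h, hev, hac] else hsol a c j hj h
    revert hne
    cases gval I C G _ <;> cases b <;> decide
  by_cases hγ : xor (xor (z (I.vars g 0)) (z (I.vars g 1))) true = y g
  · exact hval true true (by simpa using hγ)
  · -- the chord wants product `0`: transfer from `00, 10, 01` by multilinearity
    have hγ' : xor (xor (z (I.vars g 0)) (z (I.vars g 1))) false = y g := by
      revert hγ; cases z (I.vars g 0) <;> cases z (I.vars g 1) <;> cases y g <;> decide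
    have h00 := hval false false (by simpa using hγ')
    have h10 := hval true false (by simpa using hγ')
    have h01 := hval false true (by simpa using hγ')
    -- multilinearity in the two AND variables
    set w := Function.update z (I.vars g 2) false with hw
    have e1 : ∀ a c : Bool, Function.update (Function.update z (I.vars g 2) a) (I.vars g 3) c =
        Function.update (Function.update w (I.vars g 2) a) (I.vars g 3) c := by
      intro a c; rw [hw, Function.update_idem]
    rw [e1] at h00 h10 h01 ⊢
    apply bit_injective
    -- expand along `p' = vars g 3`, then along `p = vars g 2`
    have hw2 : w (I.vars g 2) = false := by rw [hw, Function.update_self]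
    have hw3 : w (I.vars g 3) = z (I.vars g 3) := by rw [hw, Function.update_of_ne h23.symm]
    have hb1 : bit true = (1 : ZMod 2) := rfl
    have hb0 : bit false = (0 : ZMod 2) := rfl
    have step : ∀ a c : Bool, bit (gval I C G (Function.update (Function.update w (I.vars g 2) a) (I.vars g 3) c)) =
        bit (gval I C G w) + bit a * alpha I C G w (I.vars g 2) +
          (bit c + bit (z (I.vars g 3))) * alpha I C G w (I.vars g 3) := by
      intro a c
      rw [bit_gval_update_and I C hnd, bit_gval_update_and I C hnd, hw2, Function.update_of_ne h23.symm, hw3,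
        alpha_update_of_ne I C w hno, hb0, add_zero]
    have e00 := step false false
    have e10 := step true false
    have e01 := step false true
    have e11 := step true true
    rw [h00] at e00
    rw [h10] at e10
    rw [h01] at e01
    simp only [hb1, hb0] at e00 e10 e01 e11
    rw [e11]
    linear_combination e00 - e10 - e01

end Chord

end Summit.PneNP.PneNP.Theorems.PstarGSatChord
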